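import Literature.GroupTheory.SpecificGroups.PGL2LinearCharP
import Literature.NumberTheory.GaloisRepresentations.GoodDihedralLocalImage
import Literature.NumberTheory.GaloisRepresentations.ProjectiveTypeSolvableAnyChar
import HarnessLib

/-!
# Finite subgroups of `PGL₂(k)` in characteristic `p`, VI: Dickson's classification of the
finite `p`-irregular subgroups for `p ≥ 5`, and the Newton–Thorne input

Topic `GroupTheory/SpecificGroups`; theorems only, no definitions, no named facts.  Sixth part of
the series `PGL2SylowCharP` (I), `PGL2BorelCharP` (II), `PGL2CountingCharP` (III),
`PGL2SubfieldCharP` (IV), `PGL2LinearCharP` (V) formalising X. Faber, *Finite `p`-irregular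
subgroups of `PGL₂(k)`*, arXiv:1112.1999 = La Matematica 2 (2023) [Faber2011] after
L. E. Dickson, *Linear groups* (1901), Ch. XII [Dickson1901].  This part assembles the
classification over an algebraically closed field of characteristic `p ≥ 5` and derives the
statement used by Newton–Thorne, *Symmetric power functoriality, II*, Publ. IHES 134 (2021), in
the proof of Prop. 3.7 [NewtonThorneIHES2021b]: "The classification of finite subgroups of
`PGL₂(𝔽̄_q)` shows that the projective image is either conjugate to a subgroup of `PGL₂(𝔽̄_5)`
or contains `PSL₂(𝔽_{q^a})` and is contained in `PGL₂(𝔽_{q^a})`".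

## Main results (all proved)

* `exists_sylow_conj_le_stabilizer`, **`exists_isNormalised_conj`** (Faber §6, first paragraph,
  with Lemma 6.2): for `k` algebraically closed, `H ≤ PGL₂(k)` finite with `p ∣ |H|` fixing no
  point of `ℙ¹(k)`, some conjugate `tHt⁻¹` is in normal form (`IsNormalised`, part IV).
* **`exists_smul_eq_or_exists_conj_eq_of_five_le` — Dickson's theorem for `p ≥ 5`**
  (Faber Thm. B / Thm. 6.1 over `k = k̄`; Dickson 1901, §260): `H` finite with `p ∣ |H|` either
  fixes a point of `ℙ¹(k)` (and is then `P ⋊ (A 0; 0 1)`, part I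
  `exists_forall_smul_eq_of_sylow_normal`), or is conjugate to `PSL₂(𝔽_q) = pslTwo 𝔽_q` or to
  `PGL₂(𝔽_q) = pglTwo 𝔽_q` for a finite subfield `𝔽_q ≤ k` (parts IV–V).
* `false_of_natCast_card_ne_zero` (the `p`-regular side, from Serre's Prop. 16
  `Serre1972.prop16_of_isAlgClosed`: cyclic groups fix a point, dihedral groups fix a point or
  stabilise a pair, `𝔄₄, 𝔖₄, 𝔄₅` have no element of order `> 5` —
  the landed `PGL2AnyChar.orderOf_perm_fin_four_le`, `orderOf_alternatingGroup_fin_five_le`), and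
  **`pslTwo_le_conj_le_pglTwo_of_five_le` — the Newton–Thorne input**: for `k` algebraically
  closed of characteristic `p ≥ 5` and `H ≤ PGL₂(k)` finite fixing no point, stabilising no pair
  `{x, y}` and containing an element of order `> 5`, there are a finite subfield `𝔽_q ≤ k` and
  `t` with `PSL₂(𝔽_q) ≤ tHt⁻¹ ≤ PGL₂(𝔽_q)`.
* `relIndex_pslTwo_pglTwo` (`[PGL₂(𝔽_q) : PSL₂(𝔽_q)] = 2`, `q` odd), `relIndex_pslTwo_dvd_two`
  and `pslTwo_le_conj_le_pglTwo_relIndex_dvd_two` (the sandwich has index dividing `2`, as used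
  in the proof of Prop. 3.7: "a group of order `2`").

## Scope

`p ≥ 5` is exactly what [NewtonThorneIHES2021b] uses (there `p ∈ sc(π)` is seasoned, so
`p ∉ {2, 3}` by Props. 3.9–3.11).  The cases `p = 3` (`PSL₂(𝔽_3)` with `q = 3`, and `𝔄₅` of
order `60`, Faber §6.1.1/§6.2.2) and `p = 2` (dihedral groups, §6.1.2–6.1.3) of Faber's Theorem B
are not assembled here (parts IV–V prove the `p = 3` statements at the level of orders), nor is
the descent to non-closed `k` (Faber Thms. C, D).

## References

* [Faber2011] X. Faber, *Finite p-irregular subgroups of PGL₂(k)*, arXiv:1112.1999 (2011); La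
  Matematica 2 (2023) 479–522 — Thm. B, Thm. 6.1, Lemma 6.2, §6 (read 2026-08-15).
* [Dickson1901] L. E. Dickson, *Linear groups with an exposition of the Galois field theory*,
  Teubner (1901), Ch. XII, §260 (main theorem).
* [NewtonThorneIHES2021b] J. Newton, J. A. Thorne, *Symmetric power functoriality for
  holomorphic modular forms, II*, Publ. Math. IHÉS 134 (2021), proof of Prop. 3.7.
* [Se72] J.-P. Serre, *Propriétés galoisiennes des points d'ordre fini des courbes elliptiques*,
  Invent. Math. 15 (1972), Prop. 16 (tree: `Serre1972.prop16_of_isAlgClosed`).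
-/

open scoped MatrixGroups OnePoint Pointwise
open Matrix MulAction

namespace Literature.GroupTheory.SpecificGroups.PGL2

open Literature.NumberTheory.GaloisRepresentations

variable {k : Type*} [Field k]


section Reduction

variable [DecidableEq k] (p : ℕ) [Fact p.Prime] [CharP k p]

omit [DecidableEq k] [Fact (Nat.Prime p)] [CharP k p] in
/-- The conjugation isomorphism `H ≃* tHt⁻¹` on underlying elements. [folklore] -/
theorem coe_equivSMul_conj (t : PGL(Fin 2, k)) (H : Subgroup PGL(Fin 2, k)) (h : H) :
    ((Subgroup.equivSMul (MulAut.conj t) H h : ↥(MulAut.conj t • H)) : PGL(Fin 2, k)) = t * h * t⁻¹ :=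
  rfl

omit [DecidableEq k] [Fact (Nat.Prime p)] [CharP k p] in
/-- … and for the inverse isomorphism. [folklore] -/
theorem coe_equivSMul_conj_symm (t : PGL(Fin 2, k)) (H : Subgroup PGL(Fin 2, k)) (x : ↥(MulAut.conj t • H)) :
    (((Subgroup.equivSMul (MulAut.conj t) H).symm x : H) : PGL(Fin 2, k)) = t⁻¹ * x * t := by
  set h := (Subgroup.equivSMul (MulAut.conj t) H).symm x with hh
  have : x = Subgroup.equivSMul (MulAut.conj t) H h := by rw [hh, MulEquiv.apply_symm_apply]
  rw [this, coe_equivSMul_conj]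
  group

omit [Fact (Nat.Prime p)] [CharP k p] in
/-- **Transport of a Sylow subgroup under conjugation**: if `P ≤ H` is a Sylow `p`-subgroup fixing
the point `t⁻¹ • ∞`, then `tPt⁻¹` is a Sylow `p`-subgroup of `tHt⁻¹` fixing `∞`. [folklore] -/
theorem exists_sylow_conj_le_stabilizer (H : Subgroup PGL(Fin 2, k)) [Finite H] (P : Sylow p H)
    (hP1 : (P : Subgroup H) ≠ ⊥) (t : PGL(Fin 2, k))
    (hfix : ∀ s ∈ (P : Subgroup H), (s : PGL(Fin 2, k)) • (t⁻¹ • (∞ : OnePoint k)) = t⁻¹ • ∞) :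
    ∃ Q : Sylow p ↥(MulAut.conj t • H), (Q : Subgroup ↥(MulAut.conj t • H)) ≠ ⊥ ∧
      (Q : Subgroup ↥(MulAut.conj t • H)) ≤ stabilizer ↥(MulAut.conj t • H) (∞ : OnePoint k) := by
  set e := Subgroup.equivSMul (MulAut.conj t) H with he
  have hrange : (P : Subgroup H) ≤ e.symm.toMonoidHom.range := by
    rw [MonoidHom.range_eq_top.mpr e.symm.surjective]; exact le_top
  refine ⟨P.comapOfInjective e.symm.toMonoidHom e.symm.injective hrange, ?_, ?_⟩
  · rw [Ne, Sylow.coe_comapOfInjective, Subgroup.eq_bot_iff_forall]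
    intro h
    apply hP1
    rw [Subgroup.eq_bot_iff_forall]
    intro s hs
    have := h (e s) (by rw [Subgroup.mem_comap]; simpa using hs)
    simpa using congrArg e.symm this
  · intro x hx
    rw [Sylow.coe_comapOfInjective, Subgroup.mem_comap] at hx
    have h1 := hfix _ hx
    change (((e.symm x : H)) : PGL(Fin 2, k)) • (t⁻¹ • (∞ : OnePoint k)) = t⁻¹ • ∞ at h1
    rw [he, coe_equivSMul_conj_symm, mul_smul, mul_smul, smul_left_cancel_iff, smul_inv_smul] at h1
    rw [mem_stabilizer_iff]
    exact h1

/-- **Reduction to normal form** (Faber 2011, §6, first paragraph: "By Lemma 6.2 we may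
conjugate `G` in order to assume that `P = (1 Γ; 0 1)` … we may conjugate `G` by an element of
the form `(1 γ; 0 1)` in order to assume that this complement is `(Λ 0; 0 1)` … we may also
assume that `1 ∈ Γ` after conjugating by `(α 0; 0 1)`").  If `p ∣ |H|` and `H` fixes no point of
`ℙ¹(k)`, some conjugate of `H` is in normal form. [cite: Faber2011, §6, Lemma 6.2] -/
theorem exists_isNormalised_conj [IsAlgClosed k] (H : Subgroup PGL(Fin 2, k)) [Finite H]
    (hdvd : p ∣ Nat.card H) (hfix : ∀ x : OnePoint k, ∃ h ∈ H, h • x ≠ x) :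
    ∃ t : PGL(Fin 2, k), IsNormalised p (MulAut.conj t • H) := by
  classical
  obtain ⟨P⟩ := (inferInstance : Nonempty (Sylow p H))
  have hP1 : (P : Subgroup H) ≠ ⊥ := P.ne_bot_of_dvd_card hdvd
  -- the fixed point `x₀` of `P`, moved to `∞` by `t₁⁻¹`
  set P₀ : Subgroup PGL(Fin 2, k) := (P : Subgroup H).map H.subtype with hP₀
  have hP₀grp : IsPGroup p P₀ := P.isPGroup'.map H.subtype
  have hP₀1 : P₀ ≠ ⊥ := by
    intro h
    apply hP1
    rwa [hP₀, Subgroup.map_eq_bot_iff_of_injective _ H.subtype_injective] at h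
  haveI : Finite P₀ := Finite.of_surjective (fun s : (P : Subgroup H) => (⟨(s : H), Subgroup.mem_map_of_mem H.subtype s.2⟩ : P₀))
    (by rintro ⟨x, hx⟩; obtain ⟨s, hs, rfl⟩ := Subgroup.mem_map.mp hx; exact ⟨⟨s, hs⟩, rfl⟩)
  obtain ⟨x₀, hx₀, -⟩ := exists_smul_eq_of_isPGroup p hP₀grp hP₀1
  have hPx₀ : ∀ s ∈ (P : Subgroup H), (s : PGL(Fin 2, k)) • x₀ = x₀ := fun s hs =>
    hx₀ _ (Subgroup.mem_map_of_mem H.subtype hs)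
  obtain ⟨t₁, ht₁⟩ := exists_smul_infty_eq x₀
  set H₁ : Subgroup PGL(Fin 2, k) := MulAut.conj t₁⁻¹ • H with hH₁
  obtain ⟨Q₁, hQ₁1, hQ₁i⟩ := exists_sylow_conj_le_stabilizer p H P hP1 t₁⁻¹ (fun s hs => by
    rw [inv_inv, ht₁]; exact hPx₀ s hs)
  have hΓ₁ : Gamma H₁ ≠ ⊥ := Gamma_ne_bot p H₁ Q₁ hQ₁1 hQ₁i
  -- translate: the homotheties `δ_a`, `a ∈ Λ`, lie in `H₂`
  obtain ⟨c, hc⟩ := exists_forall_homoth_mem_conj_transl H₁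
  set H₂ : Subgroup PGL(Fin 2, k) := MulAut.conj (transl c) • H₁ with hH₂
  have hΓ₂ : Gamma H₂ = Gamma H₁ := Gamma_conj_transl H₁ c
  obtain ⟨⟨β₀, hβ₀⟩, hβ₀0⟩ := AddSubgroup.ne_bot_iff_exists_ne_zero.mp (hΓ₂ ▸ hΓ₁ : Gamma H₂ ≠ ⊥)
  have h0 : β₀ ≠ 0 := fun h => hβ₀0 (Subtype.ext h)
  -- scale: `1 ∈ Γ(H₃)`
  set b : kˣ := (Units.mk0 β₀ h0)⁻¹ with hb
  set t : PGL(Fin 2, k) := homoth b * transl c * t₁⁻¹ with htdef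
  have hH₃ : MulAut.conj t • H = MulAut.conj (homoth b) • H₂ := by
    rw [htdef, map_mul, map_mul, mul_smul, mul_smul]
  have hti : t⁻¹ • (∞ : OnePoint k) = x₀ := by
    rw [htdef, _root_.mul_inv_rev, _root_.mul_inv_rev, inv_inv, mul_smul, mul_smul,
      inv_smul_eq_iff.mpr (homoth_smul_infty b).symm, inv_smul_eq_iff.mpr (transl_smul_infty c).symm, ht₁]
  refine ⟨t, ⟨?_, ?_, ?_, ?_⟩⟩
  · -- a non-trivial Sylow `p`-subgroup fixing `∞`
    obtain ⟨Q, hQ1, hQi⟩ := exists_sylow_conj_le_stabilizer p H P hP1 t (fun s hs => by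
      rw [hti]; exact hPx₀ s hs)
    exact ⟨Q, hQ1, hQi⟩
  · -- the stabiliser is proper: `H` does not fix `x₀`
    intro htop
    obtain ⟨h, hh, hhx⟩ := hfix x₀
    apply hhx
    have hmem : t * h * t⁻¹ ∈ MulAut.conj t • H := by
      rw [mem_conj_smul_iff]
      simpa [mul_assoc] using hh
    have := Subgroup.mem_top (⟨t * h * t⁻¹, hmem⟩ : ↥(MulAut.conj t • H))
    rw [← htop, mem_stabilizer_iff, Subgroup.smul_def] at this
    change (t * h * t⁻¹) • (∞ : OnePoint k) = ∞ at this
    rw [mul_smul, mul_smul, smul_eq_iff_eq_inv_smul, hti] at this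
    exact this
  · -- `δ_a ∈ H₃` for `a ∈ Λ(H₃) = Λ(H₁)`
    intro a ha
    rw [hH₃] at ha ⊢
    rw [Lambda_conj_of_smul_infty_eq H₂ (homoth_smul_infty b), hH₂,
      Lambda_conj_of_smul_infty_eq H₁ (transl_smul_infty c)] at ha
    rw [homoth_mem_conj_homoth_iff]
    exact hc a ha
  · -- `1 ∈ Γ(H₃)`
    rw [hH₃, hb]
    exact one_mem_Gamma_conj_homoth hβ₀ h0

end Reduction

section Classification

variable [DecidableEq k] (p : ℕ) [Fact p.Prime] [CharP k p]
variable {H : Subgroup PGL(Fin 2, k)} [Finite H]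

/-- In normal form `q = |Γ(H)| ≥ p` (`q` is a positive power of `p`). [folklore] -/
theorem IsNormalised.le_card_Gamma {p : ℕ} [Fact p.Prime] [CharP k p] (hN : IsNormalised p H) :
    p ≤ Nat.card (Gamma H) := by
  obtain ⟨P, hP1, hPi⟩ := hN.exists_sylow
  rw [card_Gamma_eq_card_sylow p H P hPi]
  have h1 : 1 < Nat.card (P : Subgroup H) := (Subgroup.one_lt_card_iff_ne_bot _).mpr hP1
  have hcard : Nat.card (P : Subgroup H) = p ^ (Nat.card H).factorization p := P.card_eq_multiplicity
  rw [hcard] at h1 ⊢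
  have hn : (Nat.card H).factorization p ≠ 0 := by
    intro h0
    rw [h0, pow_zero] at h1
    exact lt_irrefl 1 h1
  exact Nat.le_self_pow hn p

/-- **Dickson's classification of the finite `p`-irregular subgroups of `PGL₂(k)`, `p ≥ 5`**
(Faber 2011, Thm. B/Thm. 6.1 over an algebraically closed field, after Dickson 1901, Ch. XII):
let `k` be algebraically closed of characteristic `p ≥ 5` and `H ≤ PGL₂(k)` finite with `p ∣ |H|`.
Then either `H` fixes a point of `ℙ¹(k)` (and is `P ⋊ (A 0; 0 1)` by part I), or `H` is
conjugate to `PSL₂(𝔽_q)` or to `PGL₂(𝔽_q)` — the images of `SL₂(𝔽_q)`, `PGL₂(𝔽_q)` for a finite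
subfield `𝔽_q ≤ k`.  (For `p = 3` there are two further possibilities, `PSL₂(𝔽_3)`-normalisation
with `q = 3` and `𝔄₅`; for `p = 2` the dihedral groups: not treated here.)
[cite: Faber2011, Thm. B, Thm. 6.1; Dickson1901, §260] -/
theorem exists_smul_eq_or_exists_conj_eq_of_five_le [IsAlgClosed k] (hp5 : 5 ≤ p)
    (H : Subgroup PGL(Fin 2, k)) [Finite H] (hdvd : p ∣ Nat.card H) :
    (∃ x : OnePoint k, ∀ h ∈ H, h • x = x) ∨
      ∃ (F : Subfield k) (t : PGL(Fin 2, k)), Finite F ∧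
        (MulAut.conj t • H = pslTwo F ∨ MulAut.conj t • H = pglTwo F) := by
  by_cases hfix : ∃ x : OnePoint k, ∀ h ∈ H, h • x = x
  · exact Or.inl hfix
  right
  push Not at hfix
  have hp2 : p ≠ 2 := by omega
  obtain ⟨t, hN⟩ := exists_isNormalised_conj p H hdvd hfix
  have hq : 3 < Nat.card (Gamma (MulAut.conj t • H)) := lt_of_lt_of_le (by omega) hN.le_card_Gamma
  refine ⟨stabField (Gamma (MulAut.conj t • H)), t, hN.finite_stabField, ?_⟩
  rcases hN.card_Lambda_eq_or with hd | ⟨-, h2d⟩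
  · rcases hN.eq_pglTwo_or_card_eq_sixty hp2 hd with h | ⟨h3, -⟩
    · exact Or.inr h
    · omega
  · exact Or.inl (hN.eq_pslTwo hp2 h2d hq)

end Classification

/-! ### The Newton–Thorne input (`p ≥ 5`) -/

section NewtonThorne

omit [Field k] in
/-- The elements of `𝔄₄` have order at most `4` (indeed `3`). [folklore] -/
theorem orderOf_alternatingGroup_fin_four_le (σ : alternatingGroup (Fin 4)) : orderOf σ ≤ 4 := by
  rw [← Subgroup.orderOf_coe]
  exact PGL2AnyChar.orderOf_perm_fin_four_le _

omit [Field k] in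
/-- In a dihedral group the rotation `r 1` is conjugate only to itself and to its inverse.
[folklore] -/
theorem DihedralGroup.conj_r_one_eq_or {m : ℕ} (g : DihedralGroup m) :
    g * DihedralGroup.r 1 * g⁻¹ = DihedralGroup.r 1 ∨
      g * DihedralGroup.r 1 * g⁻¹ = (DihedralGroup.r 1)⁻¹ := by
  cases g with
  | r i =>
    left
    rw [DihedralGroup.r_mul_r, DihedralGroup.inv_r, DihedralGroup.r_mul_r]
    congr 1; ring
  | sr i =>
    right
    rw [DihedralGroup.sr_mul_r, DihedralGroup.inv_sr, DihedralGroup.sr_mul_sr, DihedralGroup.inv_r]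
    congr 1; ring

omit [Field k] in
/-- Every element of a finite dihedral group is `(r 1)ⁿ` or `(sr 0)(r 1)ⁿ`. [folklore] -/
theorem DihedralGroup.eq_r_one_pow_or {m : ℕ} [NeZero m] (g : DihedralGroup m) :
    (∃ n : ℕ, g = DihedralGroup.r 1 ^ n) ∨ (∃ n : ℕ, g = DihedralGroup.sr 0 * DihedralGroup.r 1 ^ n) := by
  cases g with
  | r i => exact Or.inl ⟨i.val, by rw [DihedralGroup.r_one_pow, ZMod.natCast_zmod_val]⟩
  | sr i => exact Or.inr ⟨i.val, by
      rw [DihedralGroup.r_one_pow, ZMod.natCast_zmod_val, DihedralGroup.sr_mul_r, zero_add]⟩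

variable [DecidableEq k] (p : ℕ) [Fact p.Prime] [CharP k p]

/-- **A `p`-regular element of a finite `H` (with `p ∤ |H|`) has two fixed points**, which are
exactly the fixed points of each of its non-trivial powers… here only: some point is fixed by
all its powers, and if `g ≠ 1` its fixed points form a pair `{x, y}` characterised by
`g • z = z ↔ z = x ∨ z = y`. [folklore] -/
theorem exists_pair_of_natCast_card_ne_zero [IsAlgClosed k] {H : Subgroup PGL(Fin 2, k)} [Finite H]
    (hH : ((Nat.card H : ℕ) : k) ≠ 0) {g : PGL(Fin 2, k)} (hg : g ∈ H) (hg1 : g ≠ 1) :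
    ∃ x y : OnePoint k, x ≠ y ∧ ∀ z, g • z = z ↔ z = x ∨ z = y := by
  have hpos : 0 < orderOf g := by
    rw [← Subgroup.orderOf_mk g hg]
    exact orderOf_pos _
  have hm : ((orderOf g : ℕ) : k) ≠ 0 := by
    intro h0
    apply hH
    have hdvd : orderOf g ∣ Nat.card H := by
      rw [← Subgroup.orderOf_mk g hg]
      exact orderOf_dvd_natCard _
    obtain ⟨c, hc⟩ := hdvd
    rw [hc, Nat.cast_mul, h0, zero_mul]
  exact exists_two_smul_eq_of_natCast_ne_zero hg1 hpos hm (pow_orderOf_eq_one g)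

omit [Fact (Nat.Prime p)] [CharP k p] in
/-- Powers of an element fixing `x` fix `x`. [folklore] -/
theorem zpow_smul_eq_of_smul_eq {g : PGL(Fin 2, k)} {x : OnePoint k} (hx : g • x = x) (n : ℤ) :
    (g ^ n) • x = x := by
  have hmem : g ^ n ∈ stabilizer PGL(Fin 2, k) x := Subgroup.zpow_mem _ (mem_stabilizer_iff.mpr hx) n
  exact mem_stabilizer_iff.mp hmem

omit [Fact (Nat.Prime p)] [CharP k p] in
/-- **The `p`-regular case offers nothing large**: if `|H| ≠ 0` in `k`, `H` fixes no point,
stabilises no pair and contains an element of order `> 5`, we reach a contradiction with Serre's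
list (cyclic, dihedral, `𝔄₄`, `𝔖₄`, `𝔄₅`; [Se72] Prop. 16). [cite: NewtonThorneIHES2021b, proof of Prop. 3.7] -/
theorem false_of_natCast_card_ne_zero [IsAlgClosed k] (H : Subgroup PGL(Fin 2, k)) [Finite H]
    (hH : ((Nat.card H : ℕ) : k) ≠ 0)
    (hfix : ∀ x : OnePoint k, ∃ h ∈ H, h • x ≠ x)
    (hpair : ∀ x y : OnePoint k, x ≠ y → ∃ h ∈ H, ¬ ((h • x = x ∨ h • x = y) ∧ (h • y = x ∨ h • y = y)))
    (hord : ∃ h ∈ H, 5 < orderOf h) : False := by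
  classical
  -- a normal-ish element `c ≠ 1` with `h c h⁻¹ ∈ {c, c⁻¹}` for all `h` gives a stable pair
  have key : ∀ c ∈ H, c ≠ 1 → (∀ h ∈ H, h * c * h⁻¹ = c ∨ h * c * h⁻¹ = c⁻¹) → False := by
    intro c hc hc1 hconj
    obtain ⟨x, y, hxy, hfixc⟩ := exists_pair_of_natCast_card_ne_zero hH hc hc1
    obtain ⟨h, hh, hnot⟩ := hpair x y hxy
    apply hnot
    have hc' : ∀ z : OnePoint k, (h * c * h⁻¹) • z = z ↔ c • z = z := by
      intro z
      rcases hconj h hh with e | e <;> rw [e]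
      rw [inv_smul_eq_iff, eq_comm]
    have hmove : ∀ z : OnePoint k, c • z = z → (h • z = x ∨ h • z = y) := by
      intro z hz
      rw [← hfixc, ← hc', mul_smul, mul_smul, inv_smul_smul, hz]
    exact ⟨hmove x ((hfixc x).mpr (Or.inl rfl)), hmove y ((hfixc y).mpr (Or.inr rfl))⟩
  rcases Serre1972.prop16_of_isAlgClosed H hH with hcyc | ⟨m, ⟨e⟩⟩ | he | he | he
  · -- cyclic: a generator fixes a point, hence so does `H`
    obtain ⟨g, hg⟩ := hcyc.exists_generator
    by_cases hg1 : (g : PGL(Fin 2, k)) = 1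
    · obtain ⟨h, hh, hne⟩ := hfix ∞
      obtain ⟨n, hn⟩ := Subgroup.mem_zpowers_iff.mp (hg ⟨h, hh⟩)
      apply hne
      have : h = (g : PGL(Fin 2, k)) ^ n := by
        have := congrArg (fun x : H => (x : PGL(Fin 2, k))) hn
        simpa using this.symm
      rw [this, hg1, one_zpow, one_smul]
    · obtain ⟨x, y, -, hfixg⟩ := exists_pair_of_natCast_card_ne_zero hH g.2 hg1
      obtain ⟨h, hh, hne⟩ := hfix x
      obtain ⟨n, hn⟩ := Subgroup.mem_zpowers_iff.mp (hg ⟨h, hh⟩)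
      apply hne
      have : h = (g : PGL(Fin 2, k)) ^ n := by
        have := congrArg (fun x : H => (x : PGL(Fin 2, k))) hn
        simpa using this.symm
      rw [this]
      exact zpow_smul_eq_of_smul_eq ((hfixg x).mpr (Or.inl rfl)) n
  · -- dihedral
    haveI : Finite (DihedralGroup m) := Finite.of_equiv H e.toEquiv
    haveI : NeZero m := ⟨by
      rintro rfl
      exact not_finite (DihedralGroup 0)⟩
    set c : H := e.symm (DihedralGroup.r 1) with hcdef
    set s₀ : H := e.symm (DihedralGroup.sr 0) with hs₀def
    have hconj : ∀ h ∈ H, h * c * h⁻¹ = c ∨ h * c * h⁻¹ = (c : PGL(Fin 2, k))⁻¹ := by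
      intro h hh
      have := DihedralGroup.conj_r_one_eq_or (e ⟨h, hh⟩)
      rcases this with h1 | h1
      · left
        have := congrArg (fun x => ((e.symm x : H) : PGL(Fin 2, k))) h1
        simp only [map_mul, map_inv, MulEquiv.symm_apply_apply, Subgroup.coe_mul, Subgroup.coe_inv] at this
        exact this
      · right
        have := congrArg (fun x => ((e.symm x : H) : PGL(Fin 2, k))) h1
        simp only [map_mul, map_inv, MulEquiv.symm_apply_apply, Subgroup.coe_mul, Subgroup.coe_inv] at this
        exact this
    by_cases hc1 : (c : PGL(Fin 2, k)) = 1
    · -- `H = {1, s₀}` fixes a fixed point of `s₀`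
      have helts : ∀ h ∈ H, h = 1 ∨ h = s₀ := by
        intro h hh
        rcases DihedralGroup.eq_r_one_pow_or (e ⟨h, hh⟩) with ⟨n, hn⟩ | ⟨n, hn⟩
        · left
          have := congrArg (fun x => ((e.symm x : H) : PGL(Fin 2, k))) hn
          simp only [MulEquiv.symm_apply_apply, map_pow] at this
          rw [this]
          change ((c ^ n : H) : PGL(Fin 2, k)) = 1
          rw [Subgroup.coe_pow, hc1, one_pow]
        · right
          have := congrArg (fun x => ((e.symm x : H) : PGL(Fin 2, k))) hn
          simp only [MulEquiv.symm_apply_apply, map_pow, map_mul] at this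
          rw [this]
          change ((s₀ * c ^ n : H) : PGL(Fin 2, k)) = s₀
          rw [Subgroup.coe_mul, Subgroup.coe_pow, hc1, one_pow, mul_one]
      by_cases hs1 : (s₀ : PGL(Fin 2, k)) = 1
      · obtain ⟨h, hh, hne⟩ := hfix ∞
        apply hne
        rcases helts h hh with rfl | rfl
        · exact one_smul _ _
        · rw [hs1, one_smul]
      · obtain ⟨x, y, -, hfixs⟩ := exists_pair_of_natCast_card_ne_zero hH s₀.2 hs1
        obtain ⟨h, hh, hne⟩ := hfix x
        apply hne
        rcases helts h hh with rfl | rfl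
        · exact one_smul _ _
        · exact (hfixs x).mpr (Or.inl rfl)
    · exact key c c.2 hc1 hconj
  · obtain ⟨e⟩ := he
    obtain ⟨h, hh, hord⟩ := hord
    have := orderOf_alternatingGroup_fin_four_le (e ⟨h, hh⟩)
    rw [MulEquiv.orderOf_eq, Subgroup.orderOf_mk] at this
    omega
  · obtain ⟨e⟩ := he
    obtain ⟨h, hh, hord⟩ := hord
    have := PGL2AnyChar.orderOf_perm_fin_four_le (e ⟨h, hh⟩)
    rw [MulEquiv.orderOf_eq, Subgroup.orderOf_mk] at this
    omega
  · obtain ⟨e⟩ := he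
    obtain ⟨h, hh, hord⟩ := hord
    have := orderOf_alternatingGroup_fin_five_le (e ⟨h, hh⟩)
    rw [MulEquiv.orderOf_eq, Subgroup.orderOf_mk] at this
    omega

/-- **The input of Newton–Thorne 2021, Prop. 3.7** ("The classification of finite subgroups of
`PGL₂(𝔽̄_q)` shows that the projective image … is either conjugate to a subgroup of
`PGL₂(𝔽̄_5)`" — i.e. of `𝔄₄, 𝔖₄, 𝔄₅` — "or contains `PSL₂(𝔽_{q^a})` and is contained in
`PGL₂(𝔽_{q^a})`; it acts irreducibly, does not stabilise a pair `{x, y}` (else `σ` would be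
dihedral) and contains an element of order `t/2 > 5`").  For `k` algebraically closed of
characteristic `p ≥ 5` and `H ≤ PGL₂(k)` finite fixing no point of `ℙ¹(k)`, stabilising no pair
of points and containing an element of order `> 5`, there are a finite subfield `𝔽_q ≤ k` and
`t ∈ PGL₂(k)` with `PSL₂(𝔽_q) ≤ tHt⁻¹ ≤ PGL₂(𝔽_q)`.
[cite: NewtonThorneIHES2021b, proof of Prop. 3.7; Faber2011, Thm. B/C; Dickson1901, §260] -/
theorem pslTwo_le_conj_le_pglTwo_of_five_le [IsAlgClosed k] (hp5 : 5 ≤ p)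
    (H : Subgroup PGL(Fin 2, k)) [Finite H]
    (hfix : ∀ x : OnePoint k, ∃ h ∈ H, h • x ≠ x)
    (hpair : ∀ x y : OnePoint k, x ≠ y → ∃ h ∈ H, ¬ ((h • x = x ∨ h • x = y) ∧ (h • y = x ∨ h • y = y)))
    (hord : ∃ h ∈ H, 5 < orderOf h) :
    ∃ (F : Subfield k) (t : PGL(Fin 2, k)), Finite F ∧
      pslTwo F ≤ MulAut.conj t • H ∧ MulAut.conj t • H ≤ pglTwo F := by
  by_cases hdvd : p ∣ Nat.card H
  · rcases exists_smul_eq_or_exists_conj_eq_of_five_le p hp5 H hdvd with ⟨x, hx⟩ | ⟨F, t, hF, h⟩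
    · obtain ⟨h, hh, hne⟩ := hfix x
      exact absurd (hx h hh) hne
    · refine ⟨F, t, hF, ?_⟩
      rcases h with h | h <;> rw [h]
      · exact ⟨le_rfl, pslTwo_le_pglTwo F⟩
      · exact ⟨pslTwo_le_pglTwo F, le_rfl⟩
  · exfalso
    have hH : ((Nat.card H : ℕ) : k) ≠ 0 := by
      rw [Ne, CharP.cast_eq_zero_iff k p]
      exact hdvd
    exact false_of_natCast_card_ne_zero H hH hfix hpair hord

end NewtonThorne

/-! ### `[PGL₂(𝔽_q) : PSL₂(𝔽_q)] = 2` and the sandwich -/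

section Index

variable [DecidableEq k] (p : ℕ) [Fact p.Prime] [CharP k p]

omit [DecidableEq k] [Fact (Nat.Prime p)] in
/-- **`[PGL₂(𝔽_q) : PSL₂(𝔽_q)] = 2` for `q` odd** (as subgroups of `PGL₂(k)`), from the orders
`q(q²-1)` and `q(q²-1)/2` of parts IV; used in Newton–Thorne 2021, proof of Prop. 3.7 ("the
image of `P_H` in `PGL₂(𝔽_{q^a})/PSL₂(𝔽_{q^a})`, a group of order `2`").
[cite: NewtonThorneIHES2021b, proof of Prop. 3.7; Dickson1901, §260] -/
theorem relIndex_pslTwo_pglTwo (F : Subfield k) [Finite F] (hp : p ≠ 2) :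
    (pslTwo F).relIndex (pglTwo F) = 2 := by
  classical
  haveI : Fintype F := Fintype.ofFinite F
  haveI : Finite (GL (Fin 2) F) := inferInstance
  haveI : Finite PGL(Fin 2, F) := Finite.of_surjective _ Matrix.ProjGenLinGroup.mk_surjective
  haveI : Finite (pglTwo F) := Finite.of_surjective _ (MonoidHom.rangeRestrict_surjective _)
  have hle := pslTwo_le_pglTwo F
  have h1 := Subgroup.card_mul_index ((pslTwo F).subgroupOf (pglTwo F))
  rw [Nat.card_congr (Subgroup.subgroupOfEquivOfLe hle).toEquiv] at h1
  change Nat.card (pslTwo F) * (pslTwo F).relIndex (pglTwo F) = Nat.card (pglTwo F) at h1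
  rw [card_pglTwo, ← two_mul_card_pslTwo F p hp, mul_comm 2] at h1
  have hpos : 0 < Nat.card (pslTwo F) := by
    haveI : Finite (pslTwo F) := Finite.of_surjective _ (MonoidHom.rangeRestrict_surjective _)
    exact Nat.card_pos
  exact Nat.eq_of_mul_eq_mul_left hpos h1

omit [DecidableEq k] [Fact (Nat.Prime p)] in
/-- A subgroup sandwiched between `PSL₂(𝔽_q)` and `PGL₂(𝔽_q)` contains `PSL₂(𝔽_q)` with index
dividing `2` (`q` odd). [cite: NewtonThorneIHES2021b, proof of Prop. 3.7] -/
theorem relIndex_pslTwo_dvd_two (F : Subfield k) [Finite F] (hp : p ≠ 2) {G : Subgroup PGL(Fin 2, k)}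
    (h1 : pslTwo F ≤ G) (h2 : G ≤ pglTwo F) : (pslTwo F).relIndex G ∣ 2 := by
  have h := Subgroup.relIndex_mul_relIndex (pslTwo F) G (pglTwo F) h1 h2
  rw [relIndex_pslTwo_pglTwo p F hp] at h
  exact Dvd.intro _ h

/-- **Newton–Thorne 2021, proof of Prop. 3.7, the group-theoretic input in full**: under the
hypotheses of `pslTwo_le_conj_le_pglTwo_of_five_le`, `PSL₂(𝔽_q) ≤ tHt⁻¹ ≤ PGL₂(𝔽_q)` with
`[tHt⁻¹ : PSL₂(𝔽_q)] ∣ 2`. [cite: NewtonThorneIHES2021b, proof of Prop. 3.7] -/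
theorem pslTwo_le_conj_le_pglTwo_relIndex_dvd_two [IsAlgClosed k] (hp5 : 5 ≤ p)
    (H : Subgroup PGL(Fin 2, k)) [Finite H]
    (hfix : ∀ x : OnePoint k, ∃ h ∈ H, h • x ≠ x)
    (hpair : ∀ x y : OnePoint k, x ≠ y → ∃ h ∈ H, ¬ ((h • x = x ∨ h • x = y) ∧ (h • y = x ∨ h • y = y)))
    (hord : ∃ h ∈ H, 5 < orderOf h) :
    ∃ (F : Subfield k) (t : PGL(Fin 2, k)), Finite F ∧
      pslTwo F ≤ MulAut.conj t • H ∧ MulAut.conj t • H ≤ pglTwo F ∧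
        (pslTwo F).relIndex (MulAut.conj t • H) ∣ 2 := by
  obtain ⟨F, t, hF, h1, h2⟩ := pslTwo_le_conj_le_pglTwo_of_five_le p hp5 H hfix hpair hord
  haveI := hF
  exact ⟨F, t, hF, h1, h2, relIndex_pslTwo_dvd_two p F (by omega) h1 h2⟩

end Index

end Literature.GroupTheory.SpecificGroups.PGL2
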